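import Summits.ResolutionOfSingularities.KangarooAtlas.MizutaniOneFormAmbient
import HarnessLib

/-!
# Reduction to ONE top invariant form with `dim H₁ = dim H` exactly (Mizutani 1973, Lemma 2.6, «moreover»)

Cell `pub-rosobs`, Mizutani enclosure (seat mizutani-encloser-2, gen 9). AI-written; *AI review is weaker than expert
review*; NOT a resolution-of-singularities theorem (summit relevance C).

`MizutaniOneFormAmbient.lean` realises a minimal-support top invariant form `f` of a point `𝔭` (exponent `e + 1` exactly, `f` not
defined over `k^p`) as the single top form of a point of `ℙ^m_k`, `m + 1 = |supp f| ≤ dim B(𝔭) + 1`.  Since the closedness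
`𝒥𝒟(k·f) = k·f` and «not over `k^p`» descend along EVERY coordinate embedding whose image contains `supp f`
(`jCore_dSpan_span_singleton_comp`, `span_singleton_comp_ne_span_inter_range`), one may embed into any `dim B(𝔭) + 1` coordinates
containing the support, which gives Mizutani's statement on the nose:

* `exists_minSupp_not_span_inter_range` — for `exponent B(𝔭) = e + 1`, a minimal-support `f ∈ (L_B)_{e+1}(𝔭)` whose line is not
  spanned by `k^p`-vectors;
* `exists_point_of_supported_closed_line` — a closed line `k·f` not over `k^p`, `supp f ⊆ im ι` (`ι : Fin (m+1) ↪ Fin (n+1)`), is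
  the top forms of a point of `ℙ^m_k` of exponent `e + 1` with one top form and `dim B = m`;
* **`exists_point_one_form_hsDim`** — LEMMA 2.6 «MOREOVER» AS PRINTED, for points: a point `𝔭₁` of `ℙ^{dim B(𝔭)}_k` with
  `exponent B(𝔭₁) = exponent B(𝔭)`, `dim_k (L_B)_{top}(𝔭₁) = 1` and `dim B(𝔭₁) = dim B(𝔭)`.

## References

* H. Mizutani, *Hironaka's additive group schemes*, Nagoya Math. J. 52 (1973) 85–95, Lemma 2.6 (p. 89). [Mizutani1973HironakaGroupSchemes]
* T. Oda, *Hironaka's additive group scheme, II*, Publ. RIMS 19 (1983), Thm. 3.1. [Oda1983HironakaGroupSchemeII]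
-/

noncomputable section

open MvPolynomial Literature.AlgebraicGeometry.Resolution Literature.AlgebraicGeometry.Resolution.HironakaScheme
  Literature.RingTheory.MvPolynomial

namespace Summit.ResolutionOfSingularities.KangarooAtlas.Mizutani

universe u

section Exact

variable (k : Type u) [Field k] (p : ℕ) [hp : Fact p.Prime] [CharP k p] {n : ℕ}
  (𝔭 : Ideal (MvPolynomial (Fin (n + 1)) k)) (e : ℕ)

/-- For a point of exponent exactly `e + 1`: **a minimal-support top invariant form whose line is not spanned by `k^p`-vectors**
(otherwise all minimal-support lines, which span `(L_B)_{e+1}`, would be, contradicting (iii)). [cite: Mizutani1973HironakaGroupSchemes, Lemma 2.6 and (*) (iii)] -/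
theorem exists_minSupp_not_span_inter_range [𝔭.IsPrime] (hP : IsPoint k 𝔭) (he : exponent k p 𝔭 = e + 1) :
    ∃ f, f ∈ invForms k p 𝔭 (e + 1) ∧ f ≠ 0 ∧
      (∀ g ∈ invForms k p 𝔭 (e + 1), g ≠ 0 → (∀ i, f i = 0 → g i = 0) → ∀ i, g i = 0 → f i = 0) ∧
      (k ∙ f : Submodule k (Fin (n + 1) → k)) ≠
        Submodule.span k (((k ∙ f : Submodule k (Fin (n + 1) → k)) : Set (Fin (n + 1) → k)) ∩ Set.range (frobVec k p 1)) := by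
  set V := invForms k p 𝔭 (e + 1) with hVdef
  obtain ⟨-, -, hiii⟩ := (exists_isPoint_exponent_eq_succ_iff k p e V).mp ⟨𝔭, hP, he, rfl⟩
  by_contra hall
  push Not at hall
  apply hiii
  refine le_antisymm ?_ (Submodule.span_le.mpr fun g hg => hg.1)
  conv_lhs => rw [← span_minSupp_eq k V]
  rw [Submodule.span_le]
  rintro f ⟨hfV, hf0, hmin⟩
  have hline := hall f hfV hf0 hmin
  have hf : f ∈ (k ∙ f : Submodule k (Fin (n + 1) → k)) := Submodule.mem_span_singleton_self f
  rw [hline] at hf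
  refine Submodule.span_mono ?_ hf
  exact Set.inter_subset_inter_left _ fun g hg => (Submodule.span_singleton_le_iff_mem f V).mpr hfV hg

/-- **A closed line not over `k^p`, supported in the image of a coordinate embedding `ι : Fin (m+1) ↪ Fin (n+1)`, is the top forms of a
point of `ℙ^m_k`** of exponent `e + 1`, with one top form and `dim B = m`. [cite: Mizutani1973HironakaGroupSchemes, Lemma 2.6 with Thm. 1.3] -/
theorem exists_point_of_supported_closed_line {m : ℕ} {ι : Fin (m + 1) → Fin (n + 1)} (hι : Function.Injective ι)
    {f : Fin (n + 1) → k} (hf0 : f ≠ 0) (hfsupp : ∀ i, (∀ j, ι j ≠ i) → f i = 0)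
    (hclf : jCore k p (e + 1) (dSpan k p (e + 1) (k ∙ f)) = k ∙ f)
    (hfp : (k ∙ f : Submodule k (Fin (n + 1) → k)) ≠
      Submodule.span k (((k ∙ f : Submodule k (Fin (n + 1) → k)) : Set (Fin (n + 1) → k)) ∩ Set.range (frobVec k p 1))) :
    ∃ 𝔭₁ : Ideal (MvPolynomial (Fin (m + 1)) k), IsPoint k 𝔭₁ ∧ exponent k p 𝔭₁ = e + 1 ∧
      invForms k p 𝔭₁ (e + 1) = k ∙ (f ∘ ι) ∧ Module.finrank k (invForms k p 𝔭₁ (e + 1)) = 1 ∧ hsDim k p 𝔭₁ = m := by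
  have hcl₁ := jCore_dSpan_span_singleton_comp k p (e + 1) hι hfsupp hclf
  have hfp₁ := span_singleton_comp_ne_span_inter_range k p hι hfsupp hfp
  have hne₁ := span_singleton_ne_top_of_ne_span_inter_range k p hfp₁
  obtain ⟨𝔭₁, hP₁, he₁, hinv₁⟩ :=
    (exists_isPoint_exponent_eq_succ_iff k p e (k ∙ (f ∘ ι))).mpr ⟨hne₁, hcl₁, hfp₁⟩
  haveI := hP₁.1
  have hg0 : f ∘ ι ≠ 0 := by
    intro h0
    apply hf0
    rw [← vecMul_indicator_comp_of_support k hι hfsupp, h0, Matrix.zero_vecMul]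
  have hfin : Module.finrank k (invForms k p 𝔭₁ (e + 1)) = 1 := by
    rw [hinv₁]; exact finrank_span_singleton hg0
  refine ⟨𝔭₁, hP₁, he₁, hinv₁, hfin, ?_⟩
  have hE₁ : ExponentLE k p 𝔭₁ (e + 1) := (exponent_le_iff k p 𝔭₁).mp he₁.le
  rw [← hsDimAt_eq_hsDim k p 𝔭₁ hE₁]
  unfold hsDimAt
  rw [hfin]
  omega

/-- **LEMMA 2.6 «MOREOVER» WITH `dim H₁ = dim H` EXACTLY, for points.**  For a point `𝔭` of `ℙ^n_k` with `exponent B(𝔭) = e + 1`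
there is a point `𝔭₁` of `ℙ^d_k`, `d = dim B(𝔭)`, with `exponent B(𝔭₁) = e + 1`, exactly ONE top invariant form and `dim B(𝔭₁) = d`
(embed a minimal-support top form not over `k^p` into any `d + 1` coordinates containing its support).
[cite: Mizutani1973HironakaGroupSchemes, Lemma 2.6 ("Moreover we can choose f_1 so that H_1 … is an H-scheme with dim H_1 = d and e(H_1) = e")] -/
theorem exists_point_one_form_hsDim [𝔭.IsPrime] (hP : IsPoint k 𝔭) (he : exponent k p 𝔭 = e + 1) :
    ∃ 𝔭₁ : Ideal (MvPolynomial (Fin (hsDim k p 𝔭 + 1)) k), IsPoint k 𝔭₁ ∧ exponent k p 𝔭₁ = e + 1 ∧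
      Module.finrank k (invForms k p 𝔭₁ (e + 1)) = 1 ∧ hsDim k p 𝔭₁ = hsDim k p 𝔭 := by
  classical
  have hE : ExponentLE k p 𝔭 (e + 1) := (exponent_le_iff k p 𝔭).mp he.le
  obtain ⟨hne, hcl, -⟩ := (exists_isPoint_exponent_eq_succ_iff k p e (invForms k p 𝔭 (e + 1))).mp ⟨𝔭, hP, he, rfl⟩
  obtain ⟨f, hfV, hf0, hmin, hfp⟩ := exists_minSupp_not_span_inter_range k p 𝔭 e hP he
  have hclf : jCore k p (e + 1) (dSpan k p (e + 1) (k ∙ f)) = k ∙ f :=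
    jCore_dSpan_span_singleton_of_minSupp k p (e + 1) hcl hfV hf0 hmin
  -- a set `T` of `hsDim + 1` coordinates containing the support
  set S := Finset.univ.filter fun i => f i ≠ 0 with hS
  have hScard : S.card ≤ hsDim k p 𝔭 + 1 := card_support_le_hsDim_succ k p 𝔭 (e + 1) hE hfV hf0 hmin
  have hdn : hsDim k p 𝔭 + 1 ≤ (Finset.univ : Finset (Fin (n + 1))).card := by
    rw [Finset.card_univ, Fintype.card_fin, ← hsDimAt_eq_hsDim k p 𝔭 hE]
    unfold hsDimAt
    have h1 : 1 ≤ Module.finrank k (invForms k p 𝔭 (e + 1)) := by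
      rw [Nat.one_le_iff_ne_zero]
      intro h0
      apply hf0
      have : invForms k p 𝔭 (e + 1) = ⊥ := Submodule.finrank_eq_zero.mp h0
      rw [this] at hfV
      exact hfV
    omega
  obtain ⟨T, hST, -, hTcard⟩ := Finset.exists_subsuperset_card_eq (Finset.subset_univ S) hScard hdn
  set ι : Fin (hsDim k p 𝔭 + 1) → Fin (n + 1) := fun j => T.orderEmbOfFin hTcard j with hιdef
  have hι : Function.Injective ι := fun a b h => (T.orderEmbOfFin hTcard).injective h
  have hfsupp : ∀ i, (∀ j, ι j ≠ i) → f i = 0 := by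
    intro i hi
    by_contra hfi
    have hiT : i ∈ T := hST (Finset.mem_filter.mpr ⟨Finset.mem_univ i, hfi⟩)
    have : i ∈ Set.range (T.orderEmbOfFin hTcard) := by rw [Finset.range_orderEmbOfFin]; exact hiT
    obtain ⟨j, hj⟩ := this
    exact hi j hj
  obtain ⟨𝔭₁, hP₁, he₁, -, hfin, hdim⟩ := exists_point_of_supported_closed_line k p e hι hf0 hfsupp hclf hfp
  exact ⟨𝔭₁, hP₁, he₁, hfin, hdim⟩

end Exact

end Summit.ResolutionOfSingularities.KangarooAtlas.Mizutani

end
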